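import Summits.NavierStokesRegularity.NavierStokesRegularity.Theses.RellichScar
import Summits.NavierStokesRegularity.NavierStokesRegularity.Theorems.ScarRigidity.Negative.LogicAndLoadBearing
import Literature.Analysis.FluidPDE.TypeIAncientMild
import Literature.Analysis.FluidPDE.ParasiticSlabFlow
import Literature.Analysis.FluidPDE.TypeIAncientMildClassical
import Literature.Analysis.FluidPDE.LocalLeraySolutionsSlab
import Literature.Analysis.FluidPDE.ClassicalSuitable
import Literature.Analysis.FluidPDE.LocalLerayCylinderSliceNorms
import Literature.Analysis.FluidPDE.RieszKernelBounds
import Summits.NavierStokesRegularity.NavierStokesRegularity.Theorems.SqueezeCycleExtremalElementExistsRegularity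
import Summits.NavierStokesRegularity.NavierStokesRegularity.Theorems.RellichScarScarRigidityApexBoundsCore
import HarnessLib

/-!
# `ScarRigidity` — line `finite-energy-log-convexity`, stub `stub_apexDerivativeBounds`:
# apex profiles are local Leray solutions on windows (crux stmt-NavierStokesRegularity-11717)

Helper file for S1β. For a Type-I ancient mild field `V` in the Oseen gauge with the apex bound
`‖V(t,x)‖ ≤ C/(‖x‖ + √(-t))` and a classical pressure `p` of `V` on a window `(t₀ - 1, 0)`, for
`t₀ < T_e < 0` the shifted pair `(V(· + t₀), p(· + t₀))` is a **local Leray solution on the slab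
`(0, T_e - t₀) × ℝ³`** (Lemarié-Rieusset 2016, Def. 14.1; `IsLocalLeraySolutionOn`) with datum
`V t₀`: classical solutions are suitable, the field is bounded by `C/√(-T_e)` and its gradient by
the core bound, the datum is attained by the uniform time-Lipschitz bound of the class, and the apex
bound gives the decay at spatial infinity. The apex bound also bounds the ball energies of every
slice, `∫_{B_ρ(x₀)} |V(t)|² ≤ 2α(C, ρ)` — the datum hypothesis of Jia–Šverák's a priori estimate.
-/

noncomputable section

open Set Filter Function MeasureTheory Metric TopologicalSpace
open scoped Topology ENNReal NNReal InnerProductSpace RealInnerProductSpace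
open Literature.Analysis.FluidPDE
open Summit.NavierStokesRegularity.NavierStokesRegularity.Theses.RellichScar
open Summit.NavierStokesRegularity.NavierStokesRegularity.Theorems.ScarRigidity.Negative

set_option linter.dupNamespace false

namespace Summit.NavierStokesRegularity.NavierStokesRegularity.Theorems.RellichScarScarRigidity

open Literature.Analysis

/-! ## Unit-ball energies of apex-bounded slices -/

/-- The apex bound off the origin: `‖V(t,x)‖ ≤ C/‖x‖` for `x ≠ 0` (drop `√(-t) ≥ 0`). [folklore] -/
theorem norm_le_div_norm_of_hasTypeIDecay {C : ℝ} {V : ℝ → (EuclideanSpace ℝ (Fin 3)) → (EuclideanSpace ℝ (Fin 3))} (hd : HasTypeIDecay C V)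
    (hC : 0 ≤ C) {t : ℝ} (ht : t < 0) {x : (EuclideanSpace ℝ (Fin 3))} (hx : x ≠ 0) : ‖V t x‖ ≤ C / ‖x‖ :=
  (hd t ht x).trans (div_le_div_of_nonneg_left hC (norm_pos_iff.2 hx) (by simp [Real.sqrt_nonneg]))

/-- The apex bound in the exterior of the unit ball: `‖V(t,x)‖ ≤ C` for `1 ≤ ‖x‖`. [folklore] -/
theorem norm_le_const_of_hasTypeIDecay {C : ℝ} {V : ℝ → (EuclideanSpace ℝ (Fin 3)) → (EuclideanSpace ℝ (Fin 3))} (hd : HasTypeIDecay C V)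
    (hC : 0 ≤ C) {t : ℝ} (ht : t < 0) {x : (EuclideanSpace ℝ (Fin 3))} (hx : 1 ≤ ‖x‖) : ‖V t x‖ ≤ C := by
  have hx0 : x ≠ 0 := by rintro rfl; rw [norm_zero] at hx; exact absurd hx (by norm_num)
  exact (norm_le_div_norm_of_hasTypeIDecay hd hC ht hx0).trans (div_le_self hC hx)

/-- The squared apex bound off the origin in `ℝ≥0∞`: `‖V(t,x)‖ₑ² ≤ C² · ‖x‖⁻²`. [folklore] -/
theorem enorm_sq_le_powKer_of_hasTypeIDecay {C : ℝ} {V : ℝ → (EuclideanSpace ℝ (Fin 3)) → (EuclideanSpace ℝ (Fin 3))} (hd : HasTypeIDecay C V)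
    (hC : 0 ≤ C) {t : ℝ} (ht : t < 0) {x : (EuclideanSpace ℝ (Fin 3))} (hx : x ≠ 0) :
    ‖V t x‖ₑ ^ 2 ≤ ENNReal.ofReal (C ^ 2) * RieszKernel.powKer 2 x := by
  have hxn : 0 < ‖x‖ := norm_pos_iff.2 hx
  have h1 := norm_le_div_norm_of_hasTypeIDecay hd hC ht hx
  rw [RieszKernel.powKer_apply, ← ENNReal.ofReal_mul (sq_nonneg C), ← ofReal_norm,
    ← ENNReal.ofReal_pow (norm_nonneg _)]
  refine ENNReal.ofReal_le_ofReal ?_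
  have e : C ^ 2 * ‖x‖ ^ (-(2 : ℝ)) = (C / ‖x‖) ^ 2 := by
    rw [Real.rpow_neg hxn.le, show (2 : ℝ) = (2 : ℕ) by norm_num, Real.rpow_natCast, div_pow,
      div_eq_mul_inv]
  rw [e]
  exact pow_le_pow_left₀ (norm_nonneg _) h1 2

/-- **Uniform ball energy bound for apex-bounded fields**: for every radius `ρ > 0` there is
`α = α(C, ρ)` with `∫_{B_ρ(x₀)} |V(t)|² ≤ 2α` for every `t < 0`, every centre `x₀` and every field
with the apex bound `‖V‖ ≤ C/(‖x‖ + √(-t))` — near the origin by the integrability of `‖x‖⁻²` on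
balls of `ℝ³` (`RieszKernel.lintegral_ball_powKer_lt_top`), away from it by `‖V‖ ≤ C`. [folklore] -/
theorem exists_ball_energy_bound (C : ℝ) {ρ : ℝ} (hρ : 0 < ρ) :
    ∃ α : ℝ≥0, ∀ ⦃V : ℝ → (EuclideanSpace ℝ (Fin 3)) → (EuclideanSpace ℝ (Fin 3))⦄, HasTypeIDecay C V → ∀ t < 0, ∀ x₀ : (EuclideanSpace ℝ (Fin 3)),
      ∫⁻ x in ball x₀ ρ, ‖V t x‖ₑ ^ 2 ≤ 2 * (α : ℝ≥0∞) := by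
  set I₃ : ℝ≥0∞ := ∫⁻ x in ball (0 : (EuclideanSpace ℝ (Fin 3))) (2 * ρ + 1), RieszKernel.powKer 2 x with hI₃
  have hI₃top : I₃ < ⊤ := RieszKernel.lintegral_ball_powKer_lt_top (by norm_num) _
  set A : ℝ≥0∞ := ENNReal.ofReal (C ^ 2) * (I₃ + volume (ball (0 : (EuclideanSpace ℝ (Fin 3))) (2 * ρ + 1))) with hA
  have hAtop : A ≠ ⊤ :=
    ENNReal.mul_ne_top ENNReal.ofReal_ne_top (ENNReal.add_ne_top.2 ⟨hI₃top.ne, measure_ball_lt_top.ne⟩)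
  refine ⟨A.toNNReal, fun V hd t ht x₀ => ?_⟩
  rw [ENNReal.coe_toNNReal hAtop]
  rcases le_or_gt 0 C with hC | hC
  swap
  · -- `C < 0` makes the class empty
    have h := hd t ht 0
    have hden : 0 < ‖(0 : (EuclideanSpace ℝ (Fin 3)))‖ + Real.sqrt (-t) := by simp [Real.sqrt_pos.2 (neg_pos.2 ht)]
    exact absurd ((norm_nonneg _).trans h) (not_le.2 (div_neg_of_neg_of_pos hC hden))
  have hleA : ∀ B : ℝ≥0∞, B ≤ A → B ≤ 2 * A := fun B hB =>
    hB.trans (by calc A = 1 * A := (one_mul _).symm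
      _ ≤ 2 * A := by gcongr; norm_num)
  refine hleA _ ?_
  rcases le_or_gt ‖x₀‖ (ρ + 1) with hx₀ | hx₀
  · -- near the origin: `B_ρ(x₀) ⊆ B_{2ρ+1}(0)` and the singular majorant
    have hsub : ball x₀ ρ ⊆ ball (0 : (EuclideanSpace ℝ (Fin 3))) (2 * ρ + 1) := by
      intro x hx
      rw [mem_ball, dist_eq_norm] at hx
      rw [mem_ball_zero_iff]
      calc ‖x‖ = ‖(x - x₀) + x₀‖ := by rw [sub_add_cancel]
        _ ≤ ‖x - x₀‖ + ‖x₀‖ := norm_add_le _ _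
        _ < ρ + (ρ + 1) := add_lt_add_of_lt_of_le hx hx₀
        _ = 2 * ρ + 1 := by ring
    have hae : ∀ᵐ x ∂(volume.restrict (ball (0 : (EuclideanSpace ℝ (Fin 3))) (2 * ρ + 1))), x ≠ (0 : (EuclideanSpace ℝ (Fin 3))) := by
      refine ae_restrict_of_ae ?_
      rw [ae_iff]
      simp only [ne_eq, not_not, setOf_eq_eq_singleton, measure_singleton]
    calc ∫⁻ x in ball x₀ ρ, ‖V t x‖ₑ ^ 2 ≤ ∫⁻ x in ball (0 : (EuclideanSpace ℝ (Fin 3))) (2 * ρ + 1), ‖V t x‖ₑ ^ 2 :=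
          lintegral_mono_set hsub
      _ ≤ ∫⁻ x in ball (0 : (EuclideanSpace ℝ (Fin 3))) (2 * ρ + 1), ENNReal.ofReal (C ^ 2) * RieszKernel.powKer 2 x :=
          lintegral_mono_ae (hae.mono fun x hx => enorm_sq_le_powKer_of_hasTypeIDecay hd hC ht hx)
      _ = ENNReal.ofReal (C ^ 2) * I₃ := by
          rw [hI₃, lintegral_const_mul _ (RieszKernel.measurable_powKer 2)]
      _ ≤ A := by rw [hA]; gcongr; exact le_self_add
  · -- away from the origin: `‖x‖ ≥ 1` on `B_ρ(x₀)`
    calc ∫⁻ x in ball x₀ ρ, ‖V t x‖ₑ ^ 2 ≤ ∫⁻ _ in ball x₀ ρ, ENNReal.ofReal (C ^ 2) := by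
          refine setLIntegral_mono measurable_const fun x hx => ?_
          rw [mem_ball, dist_eq_norm] at hx
          have hx1 : 1 ≤ ‖x‖ := by
            have : ‖x₀‖ ≤ ‖x‖ + ‖x - x₀‖ := by
              calc ‖x₀‖ = ‖x - (x - x₀)‖ := by rw [sub_sub_cancel]
                _ ≤ ‖x‖ + ‖x - x₀‖ := norm_sub_le _ _
            linarith
          rw [← ofReal_norm, ← ENNReal.ofReal_pow (norm_nonneg _)]
          exact ENNReal.ofReal_le_ofReal
            (pow_le_pow_left₀ (norm_nonneg _) (norm_le_const_of_hasTypeIDecay hd hC ht hx1) 2)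
      _ = ENNReal.ofReal (C ^ 2) * volume (ball (0 : (EuclideanSpace ℝ (Fin 3))) ρ) := by
          rw [setLIntegral_const, Measure.addHaar_ball_center]
      _ ≤ A := by
          rw [hA]
          gcongr
          exact (measure_mono (ball_subset_ball (by linarith))).trans le_add_self

/-- **Uniform unit-ball energy bound** (`ρ = 1`): `∫_{B_1(x₀)} |V(t)|² ≤ 2α(C)` for all `t < 0`,
all `x₀` and all fields with the apex bound — the datum hypothesis of Jia–Šverák's a priori
estimate at every restart time. [folklore] -/
theorem exists_datum_energy_bound (C : ℝ) :
    ∃ α : ℝ≥0, ∀ ⦃V : ℝ → (EuclideanSpace ℝ (Fin 3)) → (EuclideanSpace ℝ (Fin 3))⦄, HasTypeIDecay C V → ∀ t < 0, ∀ x₀ : (EuclideanSpace ℝ (Fin 3)),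
      ∫⁻ x in ball x₀ 1, ‖V t x‖ₑ ^ 2 ≤ 2 * (α : ℝ≥0∞) :=
  exists_ball_energy_bound C one_pos

/-! ## The shifted window pair is a local Leray solution -/

/-- The volume of `(0, S) × B_R(x₀)` does not depend on the centre. [folklore] -/
theorem volume_Ioo_prod_ball_apex (S R : ℝ) (x₀ : (EuclideanSpace ℝ (Fin 3))) :
    volume (Ioo (0 : ℝ) S ×ˢ ball x₀ R) = volume (Ioo (0 : ℝ) S) * volume (ball (0 : (EuclideanSpace ℝ (Fin 3))) R) := by
  rw [show (volume : Measure (ℝ × (EuclideanSpace ℝ (Fin 3)))) = (volume : Measure ℝ).prod (volume : Measure (EuclideanSpace ℝ (Fin 3)))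
    from rfl, Measure.prod_prod, Measure.addHaar_ball_center]

section Window

variable {C : ℝ} {V : ℝ → (EuclideanSpace ℝ (Fin 3)) → (EuclideanSpace ℝ (Fin 3))} {p : ℝ → (EuclideanSpace ℝ (Fin 3)) → ℝ} {t₀ Te : ℝ}

/-- The shifted classical solution: `(V(· + t₀), p(· + t₀))` is classical on
`O = (-1, -t₀) = (· + t₀)⁻¹' (t₀ - 1, 0)`. [folklore] -/
theorem isClassicalNSSolutionOn_shift (hcl : IsClassicalNSSolutionOn (Ioo (t₀ - 1) 0) 1 0 V p) :
    IsClassicalNSSolutionOn (Ioo (-1) (-t₀)) 1 0 (fun τ => V (τ + t₀)) (fun τ => p (τ + t₀)) := by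
  have h' := hcl.comp_add_right t₀
  have hset : (fun t => t + t₀) ⁻¹' Ioo (t₀ - 1) 0 = Ioo (-1) (-t₀) := by
    ext t
    simp only [mem_preimage, mem_Ioo]
    constructor
    · rintro ⟨h1, h2⟩; exact ⟨by linarith, by linarith⟩
    · rintro ⟨h1, h2⟩; exact ⟨by linarith, by linarith⟩
  rw [hset] at h'
  exact h'

/-- The slab `(0, T_e - t₀) × ℝ³` lies in the shifted window `(-1, -t₀) × ℝ³` (`T_e < 0`).
[folklore] -/
theorem slab_subset_shift (hTe : Te < 0) :
    ((slab (EuclideanSpace ℝ (Fin 3)) (Ioo 0 (Te - t₀)) isOpen_Ioo : Opens (ℝ × (EuclideanSpace ℝ (Fin 3)))) : Set (ℝ × (EuclideanSpace ℝ (Fin 3)))) ⊆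
      Ioo (-1 : ℝ) (-t₀) ×ˢ univ := by
  intro z hz
  have hz1 := mem_slab.1 hz
  exact ⟨⟨by linarith [hz1.1], by linarith [hz1.2]⟩, mem_univ _⟩

/-- **The classical gradient is a weak spatial gradient of the shifted field on the slab.**
[cite: CaffarelliKohnNirenberg1982, §2 (2.1)] -/
theorem hasWeakSpatialGradientOn_shift (hTe : Te < 0)
    (hcl : IsClassicalNSSolutionOn (Ioo (t₀ - 1) 0) 1 0 V p) :
    HasWeakSpatialGradientOn (slab (EuclideanSpace ℝ (Fin 3)) (Ioo 0 (Te - t₀)) isOpen_Ioo) (fun τ => V (τ + t₀))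
      fun τ x => fderiv ℝ (V (τ + t₀)) x :=
  hasWeakSpatialGradientOn_of_contDiffOn isOpen_Ioo (slab_subset_shift hTe)
    ((isClassicalNSSolutionOn_shift hcl).smooth_velocity.of_le (by norm_cast))

/-- A uniform bound of the shifted field on `[0, T_e - t₀] × ℝ³`: `‖V(τ + t₀, x)‖ ≤ C/√(-T_e)`.
[folklore] -/
theorem norm_shift_le (hV : IsTypeIAncientMild C V) (hTe : Te < 0) {τ : ℝ}
    (hτ : τ ∈ Icc 0 (Te - t₀)) (x : (EuclideanSpace ℝ (Fin 3))) : ‖V (τ + t₀) x‖ ≤ C / Real.sqrt (-Te) := by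
  have h1 : τ + t₀ ≤ Te := by linarith [hτ.2]
  refine (hV.norm_le (by linarith) x).trans ?_
  exact div_le_div_of_nonneg_left hV.nonneg (Real.sqrt_pos.2 (neg_pos.2 hTe))
    (Real.sqrt_le_sqrt (by linarith))

/-- **Apex profiles are local Leray solutions on windows.** For `t₀ < T_e < 0` and a classical
pressure `p` of `V` on `(t₀ - 1, 0)`, the shifted pair `(V(· + t₀), p(· + t₀))` is a local Leray
solution on `(0, T_e - t₀) × ℝ³` with datum `V t₀` (Lemarié-Rieusset 2016, Def. 14.1; all
clauses from smoothness, the bound `C/√(-T_e)`, the core gradient bound, the time-Lipschitz bound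
of the class and the apex decay). [cite: LemarieRieusset2016, Def. 14.1] -/
theorem isLocalLeraySolutionOn_shift (hV : IsTypeIAncientMild C V) (hd : HasTypeIDecay C V)
    (ht₀ : t₀ < Te) (hTe : Te < 0) (hcl : IsClassicalNSSolutionOn (Ioo (t₀ - 1) 0) 1 0 V p) :
    IsLocalLeraySolutionOn (Te - t₀) 1 (V t₀) (fun τ => V (τ + t₀)) (fun τ => p (τ + t₀)) := by
  have hC : 0 ≤ C := hV.nonneg
  set S : ℝ := Te - t₀ with hS_def
  have hS : 0 < S := sub_pos.2 ht₀
  have hvcl := isClassicalNSSolutionOn_shift hcl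
  set O : Set ℝ := Ioo (-1) (-t₀) with hO_def
  have hQ := slab_subset_shift (t₀ := t₀) hTe
  have hIccO : Icc (0 : ℝ) S ⊆ O := fun t ht => ⟨by linarith [ht.1], by linarith [ht.2, hS_def]⟩
  have hπcont : ContinuousOn (uncurry fun τ => p (τ + t₀)) (O ×ˢ univ) :=
    hvcl.smooth_pressure.continuousOn
  have hvcont : ContinuousOn (uncurry fun τ => V (τ + t₀)) (O ×ˢ univ) :=
    hvcl.smooth_velocity.continuousOn
  -- the everywhere bound
  set M : ℝ := C / Real.sqrt (-Te) with hM_def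
  have hM0 : 0 ≤ M := div_nonneg hC (Real.sqrt_nonneg _)
  have hvM : ∀ τ ∈ Icc 0 S, ∀ x, ‖V (τ + t₀) x‖ ≤ M := fun τ hτ x => norm_shift_le hV hTe hτ x
  -- the gradient bound from the core bound
  obtain ⟨K₁, hK₁0, hK₁⟩ := exists_norm_fderiv_le_core C
  set L : ℝ := K₁ / (-Te) with hL_def
  have hvL : ∀ τ ∈ Ico 0 S, ∀ x, ‖fderiv ℝ (V (τ + t₀)) x‖ ≤ L := by
    intro τ hτ x
    have h1 : τ + t₀ < Te := by linarith [hτ.2]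
    refine (hK₁ hV (τ + t₀) (by linarith) x).trans ?_
    exact div_le_div_of_nonneg_left hK₁0 (neg_pos.2 hTe) (by linarith)
  have hvol : ∀ K : Set (EuclideanSpace ℝ (Fin 3)), IsCompact K → volume (Ioo (0 : ℝ) S ×ˢ K) < ⊤ := fun K hK => by
    rw [show (volume : Measure (ℝ × (EuclideanSpace ℝ (Fin 3)))) = (volume : Measure ℝ).prod (volume : Measure (EuclideanSpace ℝ (Fin 3)))
      from rfl, Measure.prod_prod]
    exact ENNReal.mul_lt_top measure_Ioo_lt_top hK.measure_lt_top
  refine ⟨?_, ?_, ?_, ?_, ?_, ?_, ?_⟩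
  · -- (1)+(4) suitability: classical solutions are suitable
    refine isSuitableWeakSolutionOn_of_contDiffOn isOpen_Ioo hQ
      (hvcl.smooth_velocity.of_le (by norm_cast)) (hvcl.smooth_pressure.of_le (by norm_cast))
      continuousOn_const (fun t ht x => ?_) hvcl.divFree
    have hm := hvcl.momentum t ht x
    rwa [timeDerivWithin_apply, derivWithin_of_isOpen isOpen_Ioo ht, ← timeDeriv_apply] at hm
  · -- `v ∈ L²((0,S) × K)`
    intro K hK
    calc ∫⁻ z in Ioo 0 S ×ˢ K, ‖V (z.1 + t₀) z.2‖ₑ ^ 2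
        ≤ ∫⁻ _ in Ioo 0 S ×ˢ K, ENNReal.ofReal M ^ 2 := by
          refine setLIntegral_mono measurable_const fun z hz => ?_
          have h1 : ‖V (z.1 + t₀) z.2‖ₑ ≤ ENNReal.ofReal M := by
            rw [← ofReal_norm]
            exact ENNReal.ofReal_le_ofReal (hvM z.1 ⟨hz.1.1.le, hz.1.2.le⟩ z.2)
          gcongr
      _ < ⊤ := by
          rw [setLIntegral_const]
          exact ENNReal.mul_lt_top (ENNReal.pow_lt_top ENNReal.ofReal_lt_top) (hvol K hK)
  · -- `π ∈ L^{3/2}((0,S) × K)`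
    intro K hK
    have hKc : IsCompact (Icc (0 : ℝ) S ×ˢ K) := isCompact_Icc.prod hK
    have hKO : Icc (0 : ℝ) S ×ˢ K ⊆ O ×ˢ univ := prod_mono hIccO (subset_univ _)
    obtain ⟨P, hP⟩ := hKc.exists_bound_of_continuousOn (hπcont.mono hKO)
    calc ∫⁻ z in Ioo 0 S ×ˢ K, ‖p (z.1 + t₀) z.2‖ₑ ^ (3 / 2 : ℝ)
        ≤ ∫⁻ _ in Ioo 0 S ×ˢ K, ENNReal.ofReal P ^ (3 / 2 : ℝ) := by
          refine setLIntegral_mono measurable_const fun z hz => ?_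
          refine ENNReal.rpow_le_rpow ?_ (by norm_num)
          rw [← ofReal_norm]
          exact ENNReal.ofReal_le_ofReal (hP z ⟨Ioo_subset_Icc_self hz.1, hz.2⟩)
      _ < ⊤ := by
          rw [setLIntegral_const]
          exact ENNReal.mul_lt_top
            (ENNReal.rpow_lt_top_of_nonneg (by norm_num) ENNReal.ofReal_ne_top) (hvol K hK)
  · -- uniformly local energy
    intro R hR
    have hfin : ENNReal.ofReal M ^ 2 * volume (ball (0 : (EuclideanSpace ℝ (Fin 3))) R) ≠ ⊤ :=
      ENNReal.mul_ne_top (ENNReal.pow_ne_top ENNReal.ofReal_ne_top) measure_ball_lt_top.ne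
    refine ⟨(ENNReal.ofReal M ^ 2 * volume (ball (0 : (EuclideanSpace ℝ (Fin 3))) R)).toNNReal,
      (ae_restrict_mem measurableSet_Ioo).mono fun t ht x₀ => ?_⟩
    rw [ENNReal.coe_toNNReal hfin]
    calc ∫⁻ x in ball x₀ R, ‖V (t + t₀) x‖ₑ ^ 2 ≤ ∫⁻ _ in ball x₀ R, ENNReal.ofReal M ^ 2 := by
          refine setLIntegral_mono measurable_const fun x _ => ?_
          have h1 : ‖V (t + t₀) x‖ₑ ≤ ENNReal.ofReal M := by
            rw [← ofReal_norm]
            exact ENNReal.ofReal_le_ofReal (hvM t ⟨ht.1.le, ht.2.le⟩ x)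
          gcongr
      _ = ENNReal.ofReal M ^ 2 * volume (ball (0 : (EuclideanSpace ℝ (Fin 3))) R) := by
          rw [setLIntegral_const, Measure.addHaar_ball_center]
  · -- uniformly local gradient
    refine ⟨fun τ x => fderiv ℝ (V (τ + t₀)) x, hasWeakSpatialGradientOn_shift hTe hcl,
      fun R hR => ?_⟩
    have hfin : ENNReal.ofReal (3 * L ^ 2) * (volume (Ioo (0 : ℝ) S) * volume (ball (0 : (EuclideanSpace ℝ (Fin 3))) R)) ≠ ⊤ :=
      ENNReal.mul_ne_top ENNReal.ofReal_ne_top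
        (ENNReal.mul_ne_top measure_Ioo_lt_top.ne measure_ball_lt_top.ne)
    refine ⟨(ENNReal.ofReal (3 * L ^ 2) *
      (volume (Ioo (0 : ℝ) S) * volume (ball (0 : (EuclideanSpace ℝ (Fin 3))) R))).toNNReal, fun x₀ => ?_⟩
    rw [ENNReal.coe_toNNReal hfin]
    calc ∫⁻ z in Ioo 0 S ×ˢ ball x₀ R, ENNReal.ofReal (frobeniusNormSq (fderiv ℝ (V (z.1 + t₀)) z.2))
        ≤ ∫⁻ _ in Ioo 0 S ×ˢ ball x₀ R, ENNReal.ofReal (3 * L ^ 2) := by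
          refine setLIntegral_mono measurable_const fun z hz => ?_
          refine ENNReal.ofReal_le_ofReal ((frobeniusNormSq_le_three_mul_norm_sq _).trans ?_)
          have h1 := hvL z.1 ⟨hz.1.1.le, hz.1.2⟩ z.2
          have h0 : 0 ≤ ‖fderiv ℝ (V (z.1 + t₀)) z.2‖ := norm_nonneg _
          nlinarith
      _ = ENNReal.ofReal (3 * L ^ 2) * (volume (Ioo (0 : ℝ) S) * volume (ball (0 : (EuclideanSpace ℝ (Fin 3))) R)) := by
          rw [setLIntegral_const, volume_Ioo_prod_ball_apex]
  · -- the datum in `L²_loc`, through the uniform time-Lipschitz bound of the class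
    intro K hK
    obtain ⟨Λ, hΛ0, hΛ⟩ := exists_lipschitz_time_of_typeI C 0 (a := t₀ - 1) (b := Te) (δ := 1 / 2)
      (by linarith) hTe (by norm_num)
    have hLip : ∀ τ ∈ Ico 0 S, ∀ x, ‖V (τ + t₀) x - V t₀ x‖ ≤ Λ * τ := by
      intro τ hτ x
      have h := hΛ hV.continuousOn_uncurry (fun t ht => hV.isWeaklyDivFree ht)
        (fun s t hst ht x => hV.mild_eq_heatExtension hst ht x) hV.hasTypeITimeDecay
        t₀ ⟨by linarith, ht₀⟩ (τ + t₀) ⟨by linarith [hτ.1], by linarith [hτ.2]⟩ x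
      have e : ‖iteratedFDeriv ℝ 0 (V (τ + t₀)) x - iteratedFDeriv ℝ 0 (V t₀) x‖ =
          ‖V (τ + t₀) x - V t₀ x‖ := by
        simp only [iteratedFDeriv_zero_eq_comp, comp_apply, ← map_sub, LinearIsometryEquiv.norm_map]
      rwa [e, show τ + t₀ - t₀ = τ by ring, abs_of_nonneg hτ.1] at h
    have hKvol : volume K ≠ ⊤ := hK.measure_lt_top.ne
    have hmaj : Tendsto (fun τ : ℝ => ENNReal.ofReal ((Λ * τ) ^ 2) * volume K) (𝓝[>] 0) (𝓝 0) := by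
      have h1 : Tendsto (fun τ : ℝ => (Λ * τ) ^ 2) (𝓝 0) (𝓝 0) := by
        have : Tendsto (fun τ : ℝ => (Λ * τ) ^ 2) (𝓝 0) (𝓝 ((Λ * 0) ^ 2)) :=
          ((continuous_const.mul continuous_id).pow 2).tendsto 0
        rwa [mul_zero, zero_pow two_ne_zero] at this
      have h2 : Tendsto (fun τ : ℝ => ENNReal.ofReal ((Λ * τ) ^ 2)) (𝓝[>] 0) (𝓝 0) := by
        have h2' := (ENNReal.tendsto_ofReal h1).mono_left (nhdsWithin_le_nhds (s := Ioi (0 : ℝ)))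
        rwa [ENNReal.ofReal_zero] at h2'
      have h3 := ENNReal.Tendsto.mul_const h2 (Or.inr hKvol)
      rwa [zero_mul] at h3
    have hev : ∀ᶠ τ in 𝓝[>] (0 : ℝ), ∫⁻ x in K, ‖V (τ + t₀) x - V t₀ x‖ₑ ^ 2 ≤
        ENNReal.ofReal ((Λ * τ) ^ 2) * volume K := by
      filter_upwards [Ioo_mem_nhdsGT hS] with τ hτ
      calc ∫⁻ x in K, ‖V (τ + t₀) x - V t₀ x‖ₑ ^ 2 ≤ ∫⁻ _ in K, ENNReal.ofReal ((Λ * τ) ^ 2) := by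
            refine setLIntegral_mono measurable_const fun x _ => ?_
            rw [← ofReal_norm, ← ENNReal.ofReal_pow (norm_nonneg _)]
            exact ENNReal.ofReal_le_ofReal
              (pow_le_pow_left₀ (norm_nonneg _) (hLip τ ⟨hτ.1.le, hτ.2⟩ x) 2)
        _ = ENNReal.ofReal ((Λ * τ) ^ 2) * volume K := by
            rw [setLIntegral_const]
    exact tendsto_of_tendsto_of_tendsto_of_le_of_le' tendsto_const_nhds hmaj
      (Eventually.of_forall fun _ => bot_le) hev
  · -- decay at spatial infinity, from the apex bound `‖V‖ ≤ C/‖x‖`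
    intro R hR
    have hbound : ∀ x₀ : (EuclideanSpace ℝ (Fin 3)), R + 1 ≤ ‖x₀‖ →
        ∫⁻ z in Ioo 0 S ×ˢ ball x₀ R, ‖V (z.1 + t₀) z.2‖ₑ ^ 2 ≤
          ENNReal.ofReal ((C / (‖x₀‖ - R)) ^ 2) * (volume (Ioo (0 : ℝ) S) * volume (ball (0 : (EuclideanSpace ℝ (Fin 3))) R)) := by
      intro x₀ hx₀
      have hxR : 0 < ‖x₀‖ - R := by linarith
      calc ∫⁻ z in Ioo 0 S ×ˢ ball x₀ R, ‖V (z.1 + t₀) z.2‖ₑ ^ 2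
          ≤ ∫⁻ _ in Ioo 0 S ×ˢ ball x₀ R, ENNReal.ofReal ((C / (‖x₀‖ - R)) ^ 2) := by
            refine setLIntegral_mono measurable_const fun z hz => ?_
            have hz2 : ‖z.2 - x₀‖ < R := by rw [← dist_eq_norm]; exact hz.2
            have hzn : ‖x₀‖ - R ≤ ‖z.2‖ := by
              have : ‖x₀‖ ≤ ‖z.2‖ + ‖z.2 - x₀‖ := by
                calc ‖x₀‖ = ‖z.2 - (z.2 - x₀)‖ := by rw [sub_sub_cancel]
                  _ ≤ ‖z.2‖ + ‖z.2 - x₀‖ := norm_sub_le _ _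
              linarith
            have hz0 : z.2 ≠ 0 := by
              intro h; rw [h, norm_zero] at hzn; linarith
            have ht : z.1 + t₀ < 0 := by linarith [hz.1.2, hS_def]
            rw [← ofReal_norm, ← ENNReal.ofReal_pow (norm_nonneg _)]
            refine ENNReal.ofReal_le_ofReal (pow_le_pow_left₀ (norm_nonneg _) ?_ 2)
            exact (norm_le_div_norm_of_hasTypeIDecay hd hC ht hz0).trans
              (div_le_div_of_nonneg_left hC hxR hzn)
        _ = _ := by rw [setLIntegral_const, volume_Ioo_prod_ball_apex]
    have hvolR : volume (Ioo (0 : ℝ) S) * volume (ball (0 : (EuclideanSpace ℝ (Fin 3))) R) ≠ ⊤ :=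
      ENNReal.mul_ne_top measure_Ioo_lt_top.ne measure_ball_lt_top.ne
    -- the majorant tends to zero along `cocompact`
    have hmaj : Tendsto (fun x₀ : (EuclideanSpace ℝ (Fin 3)) => ENNReal.ofReal ((C / (‖x₀‖ - R)) ^ 2) *
        (volume (Ioo (0 : ℝ) S) * volume (ball (0 : (EuclideanSpace ℝ (Fin 3))) R))) (cocompact (EuclideanSpace ℝ (Fin 3))) (𝓝 0) := by
      have h1 : Tendsto (fun r : ℝ => (C / (r - R)) ^ 2) atTop (𝓝 0) := by
        have hsub : Tendsto (fun r : ℝ => r - R) atTop atTop := tendsto_atTop_add_const_right _ _ tendsto_id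
        have hdiv : Tendsto (fun r : ℝ => C / (r - R)) atTop (𝓝 0) := tendsto_const_nhds.div_atTop hsub
        have := hdiv.pow 2
        rwa [zero_pow two_ne_zero] at this
      have h2 := h1.comp (tendsto_norm_cocompact_atTop (E := (EuclideanSpace ℝ (Fin 3))))
      have h3 := ENNReal.tendsto_ofReal h2
      rw [ENNReal.ofReal_zero] at h3
      have h4 := ENNReal.Tendsto.mul_const h3 (Or.inr hvolR)
      rwa [zero_mul] at h4
    have hev : ∀ᶠ x₀ in cocompact (EuclideanSpace ℝ (Fin 3)), ∫⁻ z in Ioo 0 S ×ˢ ball x₀ R, ‖V (z.1 + t₀) z.2‖ₑ ^ 2 ≤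
        ENNReal.ofReal ((C / (‖x₀‖ - R)) ^ 2) * (volume (Ioo (0 : ℝ) S) * volume (ball (0 : (EuclideanSpace ℝ (Fin 3))) R)) := by
      have hev' : ∀ᶠ x₀ in cocompact (EuclideanSpace ℝ (Fin 3)), R + 1 ≤ ‖x₀‖ :=
        (tendsto_norm_cocompact_atTop (E := (EuclideanSpace ℝ (Fin 3)))).eventually (eventually_ge_atTop (R + 1))
      exact hev'.mono fun x₀ hx₀ => hbound x₀ hx₀
    exact tendsto_of_tendsto_of_tendsto_of_le_of_le' tendsto_const_nhds hmaj
      (Eventually.of_forall fun _ => bot_le) hev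

end Window

/-! ## Registered sub-goal (helper stub of `stub_apexDerivativeBounds`) -/

/-- **Registered helper stub `stub_apexLocalLeray`** (sub-goal of `stub_apexDerivativeBounds`,
crux stmt-NavierStokesRegularity-11717): on every window `[t₀, T_e)`, `t₀ < T_e < 0`, a Type-I
ancient mild apex profile with a classical window pressure is, after the time shift, a local Leray
solution on `(0, T_e - t₀) × ℝ³` with datum `V t₀` (Lemarié-Rieusset 2016, Def. 14.1).
[cite: LemarieRieusset2016, Def. 14.1] -/
theorem stub_apexLocalLeray :
    ∀ (V : ℝ → EuclideanSpace ℝ (Fin 3) → EuclideanSpace ℝ (Fin 3)) (p : ℝ → EuclideanSpace ℝ (Fin 3) → ℝ)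
      (C t₀ Te : ℝ), IsTypeIAncientMild C V → HasTypeIDecay C V → t₀ < Te → Te < 0 →
      IsClassicalNSSolutionOn (Ioo (t₀ - 1) 0) 1 0 V p →
      IsLocalLeraySolutionOn (Te - t₀) 1 (V t₀) (fun τ => V (τ + t₀)) (fun τ => p (τ + t₀)) :=
  fun _ _ _ _ _ hV hd ht hTe hcl => isLocalLeraySolutionOn_shift hV hd ht hTe hcl

end Summit.NavierStokesRegularity.NavierStokesRegularity.Theorems.RellichScarScarRigidity

end
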